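import Summits.BirchSwinnertonDyer.BirchSwinnertonDyer.Theorems.EisensteinPrimesGreenbergCorankAlgebra
import Literature.NumberTheory.GaloisRepresentations.ContinuousCohomologyMultiplicationSequences
import Literature.NumberTheory.GaloisRepresentations.ContinuousCohomologyAdditiveTransport
import Literature.NumberTheory.GaloisRepresentations.CohomologicalDimension
import Mathlib.Algebra.Module.CharacterModule
import HarnessLib

/-!
# Weak Leopoldt on the anticyclotomic line, part 1 — the DESCENT ALGEBRA: a cofree module is divisible;
# a cofinitely generated module of corank `0` divisible by every `f ≠ 0` vanishes; `cd_p(Γ) ≤ 2` makes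
# `H²(Γ, 𝐃)` as divisible as `𝐃`; hence `corank_Λ H²(Γ, 𝐃) = 0 ⟹ H²(Γ, 𝐃) = 0` for a cofree `𝐃`
# (cell `bsd-eis`, seat `bsd-line-x1-p1-w2` gen 4; crux 2 `GoodLatticeBDPValue` stmt-BirchSwinnertonDyer-19032, line `halves`)

HONEST FRAMING (cell `bsd-eis`, run/shared/lean/pub/bsd-eis/): pure module theory and continuous cohomology of an
abstract compact group (no definition, no named fact, no `sorry`, no `Theses` import); nothing about any curve is
asserted; BSD / IMC2 / KY Thm. 1.4.1 are proved for NO curve here. Helper `--supports stmt-BirchSwinnertonDyer-19032`;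
closes no registered stub.

## Why (the V21 index road, input WL)

LEAD g4's memo `Cruxes/GoodLatticeBDPValue/Lines/halves-imprimLambda-index-road.md` §3 lists, among the inputs of the
exact `λ`-identity (KY Thm. 1.4.1 (iii)), **WL_A: `H²(G, A_?) = 0`** for `G = Gal(K_Σ/K_∞)` (`K_∞` the ANTICYCLOTOMIC
`ℤ_p`-extension) and the three modules `A_? ∈ {E[p^∞], (F/𝒪)(θsub), (F/𝒪)(θquot)}` (step (6): `u_? = d H²(G, N_?)` by
the level-2 Kummer sequence). What the cell HAS over `K` is the corank statement for the one-variable twist deformation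
`𝐃₁ = bigRep κ ρ₀` (LEAD g2 `AcTwistDeformation.hasCorank_H1_one_and_H2_zero`: `corank_Λ H²(K_Σ/K, 𝐃₁) = 0` by the
corank squeeze; w3 g3 `…SURRank` for rank `n`). Corank `0` is NOT vanishing (`(Λ/(T − p))^∨ ≅ ℚ_p/ℤ_p` has corank
`0`); THIS FILE supplies the algebra that upgrades it to VANISHING when the coefficient module is cofree and the group has
`p`-cohomological dimension `≤ 2` (as `G_{K,Σ}` does, `p` odd: NSW (8.3.18) = the tree's PUB fact
`groupCdLE_two_galoisGroupUnramifiedOutside`):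

* §1 `smul_surjective_of_isCofree` — over a domain `Λ`, a COFREE `Λ`-module `S` (`Greenberg2016.IsCofree`: finite free
  Pontryagin dual) is divisible by every `f ≠ 0` (`f•` on the dual `Hom(S, ℚ/ℤ)` is injective, and Pontryagin duality
  turns that into surjectivity of `f•` on `S`, Mathlib `CharacterModule.surjective_of_dual_injective`);
  `subsingleton_of_hasCorank_zero_of_smul_surjective` — a COFINITELY GENERATED module of CORANK `0` that is divisible
  by every `f ≠ 0` is `0` (its dual is finitely generated torsion, hence killed by one `f ≠ 0`,
  `Submodule.annihilator_top_inter_nonZeroDivisors`; then every character factors through `S/fS = 0`).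
* §2 `smul_H_surjective_of_groupCdLE` — for a COMPACT group `Γ` with `cd_p(Γ) ≤ n` (`GroupCdLE Γ p n`), a discrete
  `p`-primary `Λ`-module `𝐃` with a continuous `Λ`-linear action, and `f ∈ Λ` with `f • 𝐃 = 𝐃`:
  `f • Hⁿ(Γ, 𝐃) = Hⁿ(Γ, 𝐃)` — the long exact sequence of `0 → 𝐃[f] → 𝐃 →f 𝐃 → 0`
  (`DiscreteCochainsLongExact`: `IsSES.exists_connectingHom`) ends in `Hⁿ⁺¹(Γ, 𝐃[f]) = 0`, and the map induced by `f•`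
  on `Hⁿ` IS `f•` (computed on homogeneous cochains, as in `ContinuousCohomologyMultiplicationSequences`).
* §3 `subsingleton_H_of_hasCorank_zero_of_isCofree` — the conjunction: `Γ` compact, `cd_p(Γ) ≤ n`, `𝐃` discrete
  `p`-primary COFREE over a domain `Λ`, `Hⁿ(Γ, 𝐃)` cofinitely generated of corank `0` ⟹ `Hⁿ(Γ, 𝐃) = 0`; and the
  variant `…_of_smul_surjective` with divisibility of `𝐃` as the hypothesis instead of cofreeness.

Sequel (this seat): the one-variable Shapiro isomorphism `Hⁱ(K_Σ/K, 𝐃₁) ≃+ Hⁱ(K_Σ/K_∞, A)` in every degree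
(`…AcTwistDeformationShapiroH`) and the assembly `H²(Gal(K_Σ/K_∞), A) = 0` (`…WeakLeopoldtAbove`).

References: [Greenberg2006] §3 A (Prop. 3.2 and its proof, pp. 358–359: the multiplication sequences; Props. 3.3–3.6:
cofree `𝒟` and `cd`), §4 A Prop. 4.1; [Greenberg2016Selmer] §2.2 p. 6 (LEO, `Ш² ⊆ H²`);
[SerreGaloisCohomology1997] I §3.1 Prop. 11 (`cd_p`), I §2.2; [NeukirchSchmidtWingberg2008] (8.3.18); the road memo.
-/

set_option autoImplicit false
set_option linter.dupNamespace false -- the summit namespace `…BirchSwinnertonDyer.BirchSwinnertonDyer.Theorems` (Sub = Summit, D-0017) trips it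

noncomputable section

open CategoryTheory Limits
open Literature.NumberTheory.GaloisRepresentations Literature.NumberTheory.IwasawaTheory.Greenberg2016
  Literature.NumberTheory.IwasawaTheory.Greenberg2006

universe u

namespace Summit.BirchSwinnertonDyer.BirchSwinnertonDyer.Theorems.WeakLeopoldtDescent

/-! ## §1 Module theory: cofree ⟹ divisible; cofinitely generated of corank `0` and divisible ⟹ `0` -/

section Algebra

variable {Λ : Type u} [CommRing Λ] {S : Type u} [AddCommGroup S] [Module Λ S]

/-- On the canonical Pontryagin dual `Hom(S, ℚ/ℤ)`, the dual of multiplication by `f` on `S` is multiplication by `f`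
(the `Λ`-structure of `CharacterModule S` is `(f • c)(s) = c(f • s)`). [cite: Greenberg2016Selmer, §1 p. 2 L17–35] -/
theorem characterModule_dual_lsmul (f : Λ) (c : CharacterModule S) :
    CharacterModule.dual (LinearMap.lsmul Λ S f) c = f • c := by
  ext s
  rfl

/-- **A cofree module over a domain is divisible**: if the Pontryagin dual of `S` is a finite free `Λ`-module
(`IsCofree Λ S`) and `f ≠ 0`, then `f • S = S`. Proof: `f•` is injective on the torsion-free dual, and by Pontryagin
duality (`CharacterModule.surjective_of_dual_injective`) `f•` is onto `S`.
[cite: Greenberg2006, §3 A (p. 358 L1–8: "`𝒟` is a cofree `R`-module … divisible")] -/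
theorem smul_surjective_of_isCofree [IsDomain Λ] (h : IsCofree Λ S) {f : Λ} (hf : f ≠ 0) :
    Function.Surjective (fun s : S ↦ f • s) := by
  obtain ⟨hfree, -⟩ := h.characterModule
  have hinj : Function.Injective (CharacterModule.dual (LinearMap.lsmul Λ S f)) := by
    intro c c' hcc'
    rw [characterModule_dual_lsmul, characterModule_dual_lsmul] at hcc'
    exact smul_right_injective (CharacterModule S) hf hcc'
  exact CharacterModule.surjective_of_dual_injective (LinearMap.lsmul Λ S f) hinj

/-- **A cofinitely generated module of corank `0` which is divisible by every `f ≠ 0` vanishes** (`Λ` a domain): the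
dual `X = Hom(S, ℚ/ℤ)` is finitely generated (`IsCofinitelyGenerated`) and torsion (`HasCorank 0`,
`isCotorsion_of_isCofinitelyGenerated_of_hasCorank_zero`), hence killed by one `a ≠ 0`
(`Submodule.annihilator_top_inter_nonZeroDivisors`); every character `c` then satisfies `c(a • t) = (a • c)(t) = 0`,
and `a • S = S`, so `c = 0` and `S = 0` (characters separate points). [cite: Greenberg2006, §3 A (Prop. 3.2, p. 358); §4 A p. 367 L33–39] -/
theorem subsingleton_of_hasCorank_zero_of_smul_surjective [IsDomain Λ] (hfg : IsCofinitelyGenerated Λ S)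
    (h0 : HasCorank Λ S 0) (hdiv : ∀ f : Λ, f ≠ 0 → Function.Surjective (fun s : S ↦ f • s)) :
    Subsingleton S := by
  have htors : Module.IsTorsion Λ (CharacterModule S) :=
    GreenbergFullAtSelmer.isCotorsion_of_isCofinitelyGenerated_of_hasCorank_zero hfg h0 _ _
      (isDualPairing_characterModule Λ S)
  haveI : Module.Finite Λ (CharacterModule S) := hfg _ _ (isDualPairing_characterModule Λ S)
  obtain ⟨a, ha, ha0⟩ := Submodule.annihilator_top_inter_nonZeroDivisors htors
  have ha' : (a : Λ) ≠ 0 := nonZeroDivisors.ne_zero ha0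
  refine subsingleton_of_forall_eq 0 fun s ↦ CharacterModule.eq_zero_of_character_apply fun c ↦ ?_
  obtain ⟨t, rfl⟩ := hdiv a ha' s
  have hc : a • c = 0 := Submodule.mem_annihilator.mp ha c Submodule.mem_top
  have h1 : (a • c) t = 0 := by rw [hc]; rfl
  simpa only [CharacterModule.smul_apply] using h1

/-- **Corank `0` + cofree ⟹ `0` for the COEFFICIENTS themselves is false** — but for a cofinitely generated module
of corank `0` that is a priori divisible the previous lemma applies; packaged with cofreeness of an AMBIENT module
acting: if `S` is cofinitely generated of corank `0` and divisible by every `f ≠ 0`, then `S = 0`. (Restatement of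
`subsingleton_of_hasCorank_zero_of_smul_surjective` with the divisibility supplied by a map from a cofree module:
`π : D → S` onto and `Λ`-linear transports divisibility.) [cite: Greenberg2006, §3 A (p. 358)] -/
theorem subsingleton_of_hasCorank_zero_of_surjective_of_isCofree [IsDomain Λ] {D : Type u} [AddCommGroup D]
    [Module Λ D] (hD : IsCofree Λ D) (π : D →ₗ[Λ] S) (hπ : Function.Surjective π)
    (hfg : IsCofinitelyGenerated Λ S) (h0 : HasCorank Λ S 0) : Subsingleton S := by
  refine subsingleton_of_hasCorank_zero_of_smul_surjective hfg h0 fun f hf s ↦ ?_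
  obtain ⟨d, rfl⟩ := hπ s
  obtain ⟨d', hd'⟩ := smul_surjective_of_isCofree hD hf d
  exact ⟨π d', by simp only [← map_smul, hd']⟩

end Algebra

/-! ## §2 Continuous cohomology: `cd_p(Γ) ≤ n` makes `Hⁿ(Γ, 𝐃)` as divisible as `𝐃` -/

section Cohomology

open _root_.TopRep _root_.ContRepresentation _root_.ContinuousCohomology

variable {Λ : Type u} [CommRing Λ] [TopologicalSpace Λ]
  {Γ : Type u} [Group Γ] [TopologicalSpace Γ] [IsTopologicalGroup Γ] [CompactSpace Γ]
  {D : Type u} [AddCommGroup D] [Module Λ D] [TopologicalSpace D] [DiscreteTopology D] [ContinuousSMul Λ D]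
  (ρ : ContinuousRep Γ Λ D)

omit [TopologicalSpace Λ] [IsTopologicalGroup Γ] [CompactSpace Γ] [TopologicalSpace D] [DiscreteTopology D]
  [ContinuousSMul Λ D] in
/-- A submodule of a `p`-primary module is `p`-primary. [folklore] -/
theorem isPrimaryTorsion_submodule {p : ℕ} (hD : IsPrimaryTorsion p D) (W : Submodule Λ D) :
    IsPrimaryTorsion p W := fun w ↦ by
  obtain ⟨r, hr⟩ := hD (w : D)
  exact ⟨r, Subtype.ext (by rw [Submodule.coe_smul_of_tower, Submodule.coe_zero]; exact hr)⟩

omit [CompactSpace Γ] in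
/-- **`cd_p(Γ) ≤ n ⟹ Hⁿ⁺¹(Γ, 𝐃) = 0` for a `Λ`-linear action on a discrete `p`-primary `𝐃`** — the tree's
`GroupCdLE Γ p n` speaks of `ℤ`-linear actions; continuous cohomology does not see the scalars
(`subsingleton_continuousCohomology_iff_of_continuousAddEquiv` along the identity of `𝐃`).
[cite: SerreGaloisCohomology1997, I §3.1 Prop. 11] [cite: Brown1982CohomologyGroups, III.1 Example 3] -/
theorem subsingleton_continuousCohomology_of_groupCdLE {p n : ℕ} (hcd : GroupCdLE Γ p n)
    (hD : IsPrimaryTorsion p D) : Subsingleton (continuousCohomology (n + 1) ρ.toTopRep) :=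
  (subsingleton_continuousCohomology_iff_of_continuousAddEquiv (X := (ρ.restrictScalars ℤ).toTopRep)
    (Y := ρ.toTopRep) (ContinuousAddEquiv.refl D) (fun _ _ ↦ rfl) (n + 1)).mp
    (hcd D (ρ.restrictScalars ℤ) hD (Nat.lt_add_one n))

/-- **`cd_p(Γ) ≤ n` and `f • 𝐃 = 𝐃` ⟹ `f • Hⁿ(Γ, 𝐃) = Hⁿ(Γ, 𝐃)`** for a compact group `Γ`, a discrete `p`-primary
`Λ`-module `𝐃` with a continuous `Λ`-linear action and any scalar `f`: the long exact sequence of the short exact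
sequence of discrete `Γ`-modules `0 → 𝐃[f] → 𝐃 →f 𝐃 → 0` (built inside the proof, as in
`ContinuousCohomologyMultiplicationSequences`; `DiscreteCochainsLongExact`: `IsSES.exists_connectingHom`) gives
`Hⁿ(Γ, 𝐃) →f Hⁿ(Γ, 𝐃) → Hⁿ⁺¹(Γ, 𝐃[f]) = 0` (`subsingleton_continuousCohomology_of_groupCdLE` on the `p`-primary
discrete module `𝐃[f]`), and the map induced by `f•` on `Hⁿ` IS `f•` (computed on the standard resolution and on
homogeneous cochains: the `Λ`-module structure of continuous cohomology comes from the coefficients).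
[cite: Greenberg2006, §3 A (Props. 3.2–3.6, pp. 358–360; p. 359 L4–6 "the composite map … is multiplication by `λ`")]
[cite: SerreGaloisCohomology1997, I §3.1 Prop. 11] -/
theorem smul_H_surjective_of_groupCdLE {p n : ℕ} (hcd : GroupCdLE Γ p n) (hD : IsPrimaryTorsion p D)
    (f : Λ) (hf : Function.Surjective (fun d : D ↦ f • d)) :
    Function.Surjective (fun c : ρ.H n ↦ f • c) := by
  -- the two structure morphisms `𝐃[f] ↪ 𝐃` and `f• : 𝐃 → 𝐃`
  let W : Submodule Λ D := Submodule.torsionBy Λ D f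
  have hW : ∀ g, W ≤ W.comap (ρ g) := ρ.torsionBy_smul_le_comap f
  let ρ₁ := ρ.subrepresentation W hW
  let ι : ρ₁.toTopRep ⟶ ρ.toTopRep := TopRep.ofHom
    { toLinearMap := W.subtype
      cont := continuous_subtype_val
      isIntertwining' := fun _ ↦ rfl }
  let μ : ρ.toTopRep ⟶ ρ.toTopRep := TopRep.ofHom
    { toLinearMap := DistribSMul.toLinearMap Λ D f
      cont := continuous_of_discreteTopology
      isIntertwining' := fun g ↦ by
        ext d
        change f • ρ g d = ρ g (f • d)
        rw [(ρ g).map_smul] }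
  -- `0 → 𝐃[f] → 𝐃 →f 𝐃 → 0` is short exact
  have hSES : IsSES ι μ :=
    { comp_eq_zero := by
        ext w
        change f • ((w : W) : D) = 0
        exact (Submodule.mem_torsionBy_iff f (w : D)).1 w.2
      injective := Subtype.val_injective
      exact_mid := fun y hy ↦ ⟨⟨y, (Submodule.mem_torsionBy_iff f y).2 hy⟩, rfl⟩
      surjective := hf }
  -- the map induced by `μ` on the resolution, on cochains, on `Hⁿ` is multiplication by `f`
  have hres : ∀ (m : ℕ) (v : resolutionX ρ.toTopRep m), (resolutionHom μ m).hom v = f • v := by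
    intro m
    induction m with
    | zero => intro v; rfl
    | succ m ih =>
      intro F
      ext x
      rw [resolutionHom_succ_hom_apply, ih, ContinuousMap.smul_apply]
  have hcoch : ∀ (i : ℕ) (σ : (homogeneousCochains ρ.toTopRep).X i), (cochainsHom μ).f i σ = f • σ :=
    fun i σ ↦ Subtype.ext (by rw [cochainsHom_f_coe, hres]; rfl)
  have hH : ∀ c : continuousCohomology n ρ.toTopRep, cohomologyMap μ n c = f • c := by
    intro c
    obtain ⟨σ, hσ, rfl⟩ := cxClass_surjective (homogeneousCochains ρ.toTopRep) n (n + 1) (up_nat_next n) c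
    have hσf : (homogeneousCochains ρ.toTopRep).d n (n + 1) (f • σ) = 0 := by
      rw [map_smul, hσ, smul_zero]
    change HomologicalComplex.homologyMap (cochainsHom μ) n _ = _
    rw [homologyMap_cxClass (cochainsHom μ) n (n + 1) (up_nat_next n) σ hσ (f • σ) hσf (hcoch n σ).symm,
      cxClass_smul]
  -- `Hⁿ⁺¹(Γ, 𝐃[f]) = 0`
  haveI h3 : Subsingleton (continuousCohomology (n + 1) ρ₁.toTopRep) :=
    subsingleton_continuousCohomology_of_groupCdLE ρ₁ hcd (isPrimaryTorsion_submodule hD W)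
  -- exactness at `Hⁿ(Γ, 𝐃)` (third term): `ker ∂ ⊆ im Hⁿ(μ)`, and `∂ = 0`
  obtain ⟨δ, -, hδ, -, -⟩ := hSES.exists_connectingHom n
  intro c
  obtain ⟨b, hb⟩ := hδ c (Subsingleton.elim _ _)
  refine ⟨b, ?_⟩
  change f • b = c
  rw [← hH b]
  exact hb

end Cohomology

/-! ## §3 The conjunction: `corank_Λ Hⁿ(Γ, 𝐃) = 0 ⟹ Hⁿ(Γ, 𝐃) = 0` for cofree `𝐃` and `cd_p(Γ) ≤ n` -/

section Vanishing

variable {Λ : Type u} [CommRing Λ] [IsDomain Λ] [TopologicalSpace Λ]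
  {Γ : Type u} [Group Γ] [TopologicalSpace Γ] [IsTopologicalGroup Γ] [CompactSpace Γ]
  {D : Type u} [AddCommGroup D] [Module Λ D] [TopologicalSpace D] [DiscreteTopology D] [ContinuousSMul Λ D]
  (ρ : ContinuousRep Γ Λ D)

/-- **`Hⁿ(Γ, 𝐃) = 0` from `corank_Λ Hⁿ(Γ, 𝐃) = 0`** when `Γ` is compact with `cd_p(Γ) ≤ n`, `𝐃` is a discrete
`p`-primary `Λ`-module divisible by every `f ≠ 0` (`Λ` a domain) with a continuous `Λ`-linear action, and `Hⁿ(Γ, 𝐃)`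
is cofinitely generated (Greenberg 2006 Prop. 3.2) of corank `0`. [cite: Greenberg2006, §3 A (Props. 3.2–3.6, pp. 358–360)]
[cite: Greenberg2016Selmer, §2.2 p. 6 L22–35] -/
theorem subsingleton_H_of_hasCorank_zero_of_smul_surjective {p n : ℕ} (hcd : GroupCdLE Γ p n)
    (hD : IsPrimaryTorsion p D) (hdiv : ∀ f : Λ, f ≠ 0 → Function.Surjective (fun d : D ↦ f • d))
    (hfg : IsCofinitelyGenerated Λ (ρ.H n)) (h0 : HasCorank Λ (ρ.H n) 0) : Subsingleton (ρ.H n) :=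
  subsingleton_of_hasCorank_zero_of_smul_surjective hfg h0 fun f hf ↦
    smul_H_surjective_of_groupCdLE ρ hcd hD f (hdiv f hf)

/-- **`Hⁿ(Γ, 𝐃) = 0` from `corank_Λ Hⁿ(Γ, 𝐃) = 0` for a COFREE `𝐃`**: `Γ` compact with `cd_p(Γ) ≤ n`, `𝐃` a discrete
`p`-primary cofree `Λ`-module (`Λ` a domain) with a continuous `Λ`-linear action, `Hⁿ(Γ, 𝐃)` cofinitely generated of
corank `0`. For `n = 2`, `Γ = G_{K,Σ}` (`p` odd, NSW (8.3.18)) and `𝐃 = 𝐃₁ = bigRep κ ρ₀` this is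
"`corank H²(K_Σ/K, 𝐃₁) = 0 ⟹ H²(K_Σ/K, 𝐃₁) = 0`", the `K`-side form of weak Leopoldt on the anticyclotomic line.
[cite: Greenberg2006, §3 A (Props. 3.2–3.6, pp. 358–360), §4 A Prop. 4.1] [cite: Greenberg2016Selmer, §2.2 p. 6 L22–35] -/
theorem subsingleton_H_of_hasCorank_zero_of_isCofree {p n : ℕ} (hcd : GroupCdLE Γ p n)
    (hD : IsPrimaryTorsion p D) (hcf : IsCofree Λ D)
    (hfg : IsCofinitelyGenerated Λ (ρ.H n)) (h0 : HasCorank Λ (ρ.H n) 0) : Subsingleton (ρ.H n) :=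
  subsingleton_H_of_hasCorank_zero_of_smul_surjective ρ hcd hD (fun _ hf ↦ smul_surjective_of_isCofree hcf hf)
    hfg h0

end Vanishing

end Summit.BirchSwinnertonDyer.BirchSwinnertonDyer.Theorems.WeakLeopoldtDescent

end
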